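import Mathlib.MeasureTheory.Group.Measure
import HarnessLib

/-!
# Transport of Haar measures along a groupoid of topological group isomorphisms:
# compatible families `t_j = (e_{ij})_* t_i` exist
(Shelstad, *Characters and inner forms of a quasi-split group over ℝ*, Compositio Math. 39 (1979), §4 p. 20: «The measures `dg′` on
`G′` and `dt′` on a Cartan subgroup `T′` of `G′` will be arbitrary … if `T` is a Cartan subgroup of `G` choose `x ∈ G` such that
`ψ_x : T → T′` is defined over `ℝ`. Then the pair `dt′, ψ_x` defines a measure `dt` on `T`, independently of the choice of `x`»; Rogawski,
*Automorphic Representations of Unitary Groups in Three Variables* (1990), §1.7 p. 6 «compatible measures»; Langlands–Shelstad (1987),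
§1.3–1.4: the measures on `T_H ≅ T_G` transported along the admissible isomorphism.)

Topic `MeasureTheory/Group`; namespace `Literature.MeasureTheory.Group`. THEOREMS ONLY (no definition, no named fact, no instance, no
notation, no `sorry`). Node N10a of the T6a pay-down line `F0_P3a_ArchTransfersCanonicalPaydown` (cell `pub/hodgecm-mathlib`, crux H413,
LEAD DESK WORD T6-6; consumer: B-p17 (g20)'s head `Rogawski1990/ArchCompatibleFamiliesExist.lean :: exists_archCompatibleFamilies`,
signature (S1) of its interface census VERBATIM) — the PURELY MEASURE-THEORETIC half of print's measure convention (M): given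

* an index type `ι` with a family of topological groups `Z i` (the centralisers `Z(γ)` of the elements `γ` of `G′_∞ ⊔ G_∞`),
* a predicate `P` (regularity) and a relation `R` (stable conjugacy) which is an EQUIVALENCE on `P` and preserves `P`,
* for `P i` and `R i j` an isomorphism of topological groups `e i j : Z i ≃ₜ* Z j` (★ O8 `archStableCentralizerEquiv`) satisfying the
  CYCLE IDENTITY `e j k ∘ e i j = e i k` as functions (conjugator-independence, ★ `coe_archStableCentralizerEquiv_eq_of_conj_eq`),
* at every `P`-index a Haar, inversion-invariant measure `μ i` (Mathlib `haar` on the closed torus; inversion-invariance from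
  commutativity, N10-ab),

there is a family `t` of measures, Haar and inversion-invariant at every `P`-index, with **`(e i j)_* (t i) = t j`** for all `P i`, `R i j`
— conjuncts (C′)(C)(C′G) of ★ `ArchCompatibleFamiliesG` are three instances of this ONE law.

PROOF. Choose a representative `r i` of the `R`-class of `i` among the `P`-indices by `Classical.epsilon` on the predicate
`k ↦ P k ∧ R k i`; for `P i`, `R i j` the two predicates COINCIDE (`funext`∕`propext` from `hsymm`, `htrans`), so `r i = r j`, and
`P (r i) ∧ R (r i) i` (`Classical.epsilon_spec`, witness `i` by `hrefl`). With the TOTAL auxiliary transport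
`F k i := if h : P k ∧ R k i then (e k i)_* (μ k) else 0` put `t i := F (r i) i`; then `(e i j)_* (t i) = (e i j ∘ e (r i) i)_* μ (r i) =
(e (r i) j)_* μ (r i) = F (r i) j = F (r j) j = t j` (`Measure.map_map`, the cycle identity, `r i = r j`). Haar and inversion-invariance
transport along `≃ₜ*` (Mathlib `ContinuousMulEquiv.isHaarMeasure_map`; inversion-invariance since `e` commutes with inversion).

* `exists_measure_family_map_eq_of_transport` — THE HEAD (signature (S1)).
* `exists_isHaarMeasure_family_map_eq_of_transport` — the same without the inversion-invariance clause (Haar in, Haar out; no `hP` needed).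

## References
* D. Shelstad, *Characters and inner forms of a quasi-split group over ℝ*, Compositio Math. 39 (1979), §4 p. 20 [Shelstad1979].
* J. D. Rogawski, *Automorphic Representations of Unitary Groups in Three Variables*, Ann. of Math. Stud. 123 (1990), §1.7 p. 6, §4.3
  (4.3.1) p. 43 [Rogawski1990].
* R. P. Langlands, D. Shelstad, *On the definition of transfer factors*, Math. Ann. 278 (1987), §1.3–1.4 [LanglandsShelstad1987].
-/

set_option autoImplicit false

noncomputable section

open MeasureTheory MeasureTheory.Measure Set

namespace Literature.MeasureTheory.Group

section Transport

variable {ι : Type*} {Z : ι → Type*} [∀ i, Group (Z i)] [∀ i, TopologicalSpace (Z i)] [∀ i, IsTopologicalGroup (Z i)]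
  [∀ i, MeasurableSpace (Z i)] [∀ i, BorelSpace (Z i)]

/-- The image of an inversion-invariant measure under an isomorphism of topological groups is inversion-invariant (`e` commutes
with inversion). [folklore] -/
private theorem isInvInvariant_map_of_continuousMulEquiv {A B : Type*} [Group A] [Group B] [TopologicalSpace A] [TopologicalSpace B]
    [IsTopologicalGroup A] [IsTopologicalGroup B] [MeasurableSpace A] [MeasurableSpace B] [BorelSpace A] [BorelSpace B]
    (e : A ≃ₜ* B) (μ : Measure A) [μ.IsInvInvariant] : (Measure.map ⇑e μ).IsInvInvariant := by
  constructor
  have hcomm : (Inv.inv ∘ ⇑e) = (⇑e ∘ Inv.inv) := funext fun x => (map_inv e x).symm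
  calc (Measure.map ⇑e μ).inv = Measure.map Inv.inv (Measure.map ⇑e μ) := rfl
    _ = Measure.map (Inv.inv ∘ ⇑e) μ := Measure.map_map measurable_inv e.continuous.measurable
    _ = Measure.map (⇑e ∘ Inv.inv) μ := by rw [hcomm]
    _ = Measure.map ⇑e (Measure.map Inv.inv μ) := (Measure.map_map e.continuous.measurable measurable_inv).symm
    _ = Measure.map ⇑e μ := by rw [Measure.map_inv_eq_self]

/-- Class representatives by `Classical.epsilon`: for `P i`, the chosen `r := ε (k ↦ P k ∧ R k i)` satisfies `P r ∧ R r i`.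
[cite: Shelstad1979, §4 p. 20] -/
private theorem epsilon_spec_rep (P : ι → Prop) (R : ι → ι → Prop) (hrefl : ∀ (i : ι), P i → R i i) {i : ι} (hi : P i) :
    P (@Classical.epsilon ι ⟨i⟩ (fun k => P k ∧ R k i)) ∧ R (@Classical.epsilon ι ⟨i⟩ (fun k => P k ∧ R k i)) i :=
  @Classical.epsilon_spec ι (fun k => P k ∧ R k i) ⟨i, hi, hrefl i hi⟩

/-- The chosen representative is CLASS-CONSTANT: for `P i` and `R i j` the predicates `k ↦ P k ∧ R k i` and `k ↦ P k ∧ R k j` coincide.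
[cite: Shelstad1979, §4 p. 20] -/
private theorem epsilon_rep_eq (P : ι → Prop) (R : ι → ι → Prop)
    (hsymm : ∀ (i j : ι), P i → R i j → R j i) (htrans : ∀ (i j k : ι), P i → R i j → R j k → R i k)
    {i j : ι} (hi : P i) (hij : R i j) :
    @Classical.epsilon ι ⟨i⟩ (fun k => P k ∧ R k i) = @Classical.epsilon ι ⟨j⟩ (fun k => P k ∧ R k j) := by
  have hpred : (fun k => P k ∧ R k i) = (fun k => P k ∧ R k j) := by
    funext k
    refine propext ⟨fun h => ⟨h.1, htrans k i j h.1 h.2 hij⟩, fun h => ⟨h.1, ?_⟩⟩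
    exact htrans k j i h.1 h.2 (hsymm i j hi hij)
  rw [hpred]

/-- **TRANSPORT OF HAAR MEASURES ALONG A GROUPOID OF TOPOLOGICAL GROUP ISOMORPHISMS — COMPATIBLE FAMILIES EXIST** (signature (S1) of the
T6a interface census). For a predicate `P` and a relation `R` on an index type `ι` which is an equivalence on `P` (`hrefl`, `hsymm`,
`htrans`) and preserves `P` (`hP`), isomorphisms `e i j : Z i ≃ₜ* Z j` (`P i`, `R i j`) with the CYCLE IDENTITY `hcomp`
(`e j k (e i j z) = e i k z`), and measures `μ i` Haar and inversion-invariant at every `P`-index: there is a family `t` of measures on the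
`Z i`, Haar and inversion-invariant at every `P`-index, with `(e i j)_* (t i) = t j` whenever `P i`, `R i j` — [Shelstad1979, §4 p. 20]
«the pair `dt′, ψ_x` defines a measure `dt` on `T`, independently of the choice of `x`»; [Rogawski1990, §1.7] «compatible measures».
Construction: `t i := (e (r i) i)_* μ (r i)` for the class representative `r i := ε (k ↦ P k ∧ R k i)`. [cite: Shelstad1979, §4 p. 20]
[cite: Rogawski1990, §1.7 p. 6; §4.3 (4.3.1) p. 43] [cite: LanglandsShelstad1987, §1.3–1.4] -/
theorem exists_measure_family_map_eq_of_transport (P : ι → Prop) (R : ι → ι → Prop)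
    (e : ∀ (i j : ι), P i → R i j → (Z i ≃ₜ* Z j)) (hP : ∀ (i j : ι), P i → R i j → P j)
    (hrefl : ∀ (i : ι), P i → R i i) (hsymm : ∀ (i j : ι), P i → R i j → R j i)
    (htrans : ∀ (i j k : ι), P i → R i j → R j k → R i k)
    (hcomp : ∀ (i j k : ι) (hi : P i) (hj : P j) (hij : R i j) (hjk : R j k) (hik : R i k) (z : Z i),
      e j k hj hjk (e i j hi hij z) = e i k hi hik z)
    (μ : ∀ i, Measure (Z i)) (hμ : ∀ i, P i → (μ i).IsHaarMeasure ∧ (μ i).IsInvInvariant) :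
    ∃ t : ∀ i, Measure (Z i), (∀ i, P i → (t i).IsHaarMeasure ∧ (t i).IsInvInvariant) ∧
      (∀ (i j : ι) (hi : P i) (hij : R i j), Measure.map ⇑(e i j hi hij) (t i) = t j) := by
  classical
  -- the TOTAL auxiliary transport and the class representatives
  let F : ∀ k i : ι, Measure (Z i) := fun k i =>
    if h : P k ∧ R k i then Measure.map ⇑(e k i h.1 h.2) (μ k) else 0
  let r : ι → ι := fun i => @Classical.epsilon ι ⟨i⟩ (fun k => P k ∧ R k i)
  have hr : ∀ i, P i → P (r i) ∧ R (r i) i := fun i hi => epsilon_spec_rep P R hrefl hi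
  have hrr : ∀ i j, P i → R i j → r i = r j := fun i j hi hij => epsilon_rep_eq P R hsymm htrans hi hij
  have hF : ∀ k i (hk : P k) (hki : R k i), F k i = Measure.map ⇑(e k i hk hki) (μ k) := by
    intro k i hk hki
    simp only [F, dif_pos (And.intro hk hki)]
  refine ⟨fun i => F (r i) i, fun i hi => ?_, fun i j hi hij => ?_⟩
  · -- Haar and inversion-invariant: transported from `μ (r i)` along `e (r i) i`
    obtain ⟨hPr, hRr⟩ := hr i hi
    obtain ⟨hH, hI⟩ := hμ (r i) hPr
    simp only []
    rw [hF (r i) i hPr hRr]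
    exact ⟨inferInstance, isInvInvariant_map_of_continuousMulEquiv _ _⟩
  · -- the transport law
    obtain ⟨hPr, hRr⟩ := hr i hi
    have hPj : P j := hP i j hi hij
    have hRrj : R (r i) j := htrans (r i) i j hPr hRr hij
    simp only []
    have hm₁ : Measurable (⇑(e i j hi hij)) := (e i j hi hij).continuous.measurable
    have hm₂ : Measurable (⇑(e (r i) i hPr hRr)) := (e (r i) i hPr hRr).continuous.measurable
    rw [← hrr i j hi hij, hF (r i) i hPr hRr, hF (r i) j hPr hRrj, Measure.map_map hm₁ hm₂]
    congr 1
    funext z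
    exact hcomp (r i) i j hPr hi hRr hij hRrj z

/-- **The same with Haar measures only** (no inversion-invariance in, none out). [cite: Shelstad1979, §4 p. 20] [cite: Rogawski1990, §1.7 p. 6] -/
theorem exists_isHaarMeasure_family_map_eq_of_transport (P : ι → Prop) (R : ι → ι → Prop)
    (e : ∀ (i j : ι), P i → R i j → (Z i ≃ₜ* Z j))
    (hrefl : ∀ (i : ι), P i → R i i) (hsymm : ∀ (i j : ι), P i → R i j → R j i)
    (htrans : ∀ (i j k : ι), P i → R i j → R j k → R i k)
    (hcomp : ∀ (i j k : ι) (hi : P i) (hj : P j) (hij : R i j) (hjk : R j k) (hik : R i k) (z : Z i),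
      e j k hj hjk (e i j hi hij z) = e i k hi hik z)
    (μ : ∀ i, Measure (Z i)) (hμ : ∀ i, P i → (μ i).IsHaarMeasure) :
    ∃ t : ∀ i, Measure (Z i), (∀ i, P i → (t i).IsHaarMeasure) ∧
      (∀ (i j : ι) (hi : P i) (hij : R i j), Measure.map ⇑(e i j hi hij) (t i) = t j) := by
  classical
  let F : ∀ k i : ι, Measure (Z i) := fun k i =>
    if h : P k ∧ R k i then Measure.map ⇑(e k i h.1 h.2) (μ k) else 0
  let r : ι → ι := fun i => @Classical.epsilon ι ⟨i⟩ (fun k => P k ∧ R k i)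
  have hr : ∀ i, P i → P (r i) ∧ R (r i) i := fun i hi => epsilon_spec_rep P R hrefl hi
  have hrr : ∀ i j, P i → R i j → r i = r j := fun i j hi hij => epsilon_rep_eq P R hsymm htrans hi hij
  have hF : ∀ k i (hk : P k) (hki : R k i), F k i = Measure.map ⇑(e k i hk hki) (μ k) := by
    intro k i hk hki
    simp only [F, dif_pos (And.intro hk hki)]
  refine ⟨fun i => F (r i) i, fun i hi => ?_, fun i j hi hij => ?_⟩
  · obtain ⟨hPr, hRr⟩ := hr i hi
    haveI := hμ (r i) hPr
    simp only []
    rw [hF (r i) i hPr hRr]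
    infer_instance
  · obtain ⟨hPr, hRr⟩ := hr i hi
    have hRrj : R (r i) j := htrans (r i) i j hPr hRr hij
    simp only []
    have hm₁ : Measurable (⇑(e i j hi hij)) := (e i j hi hij).continuous.measurable
    have hm₂ : Measurable (⇑(e (r i) i hPr hRr)) := (e (r i) i hPr hRr).continuous.measurable
    rw [← hrr i j hi hij, hF (r i) i hPr hRr, hF (r i) j hPr hRrj, Measure.map_map hm₁ hm₂]
    congr 1
    funext z
    exact hcomp (r i) i j hPr hi hRr hij hRrj z

end Transport

end Literature.MeasureTheory.Group

end
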